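import Mathlib
import Summits.NavierStokesRegularity.NavierStokesRegularity.Theorems.EulerZoomLiouvillePowerGaugeEulerLiouvilleFadingTamePastTools
import HarnessLib

/-!
# Crux E `PowerGaugeEulerLiouville` (stmt-NavierStokesRegularity-19832): classical members with an ALGEBRAICALLY FADING
# TAME PAST are irrotational, hence trivial (the power-law twin of the LEAD's `…FadingTamePast`; line `logtime-breathers`, residue T4)

Route `EulerZoomLiouville` (NavierStokesRegularity), crux E = Seregin's power-gauged ancient-Euler Liouville statement; extra-width seat
ns-ezl-w7 g0 on line `logtime-breathers` (crux dir `Cruxes/PowerGaugeEulerLiouville/Lines/logtime-breathers.md`).  The interim LEAD's physical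
form of the line's stub T2b (`FadingPast.curl_eq_zero`, `FadingPast.ae_eq_zero_of_gauge_of_fadingTamePast`, files `…FadingTamePastTools` /
`…FadingTamePast`) kills classical members whose velocity fades EXPONENTIALLY into the past, `‖u(t, y)‖ ≤ M e^{ct}` — the shape of the log-time
breathers `e^{cτ}V(e^{−cτ}y)`, `c > 0`.  The POWER CLOCKS `u(τ, y) = (T₀−τ)^{g−1} W((T₀−τ)^{−g} y)` of the line's residue T4 with a NEGATIVE
rate `g < 0` fade ALGEBRAICALLY, `‖u(τ, ·)‖_∞ ≤ B (T₀−τ)^{g−1}`, and `g < 0` is exactly the condition for this envelope to be INTEGRABLE at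
`τ = −∞`.  The LEAD's Lagrangian mechanism needs nothing more.  This file is the abstract physical stratum:

a classical Euler solution `(u, p)` on a past sub-slab `(−∞, T₁)`, `T₁ ≤ T₀`, with
* velocity envelope `‖u(s, y)‖ ≤ M (T₀ − s)^{−m}` for some `m > 1` (FINITE BACKWARD DISPLACEMENT `≤ (M/(m−1)) (T₀−r₁)^{1−m}` before time `r₁`,
  `FadingPowerPast.norm_evolutionMap_sub_le`),
* uniformly Lipschitz slices `‖∇u(s, ·)‖ ≤ K` (to own the particle-trajectory flow on `(−∞, T₁)`),
* and, OFF EVERY BALL, an integrable algebraic decay of the gradient in time: for every `δ > 0` there are `D` and `k > 1` with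
  `‖∇u(s, y)‖ ≤ D (T₀ − s)^{−k}` whenever `s < T₁`, `‖y‖ ≥ δ`,

is IRROTATIONAL on `(−∞, T₁)` (`FadingPowerPast.curl_eq_zero`), and a member of the class with such a past is trivial
(`FadingPowerPast.ae_eq_zero_of_gauge_of_fadingPowerPast`, via the tree's `PastIrrotational.ae_eq_zero_of_gauge_of_pastIrrotational`).

MECHANISM (the LEAD's, verbatim up to the rates).  Follow the fluid particle `P(r) = φ(r, τ, x)` backward from `(τ, x)`.  Its speed
`M (T₀−r)^{−m}` is integrable on `(−∞, τ]`, so EITHER the particle is TRAPPED, `‖P(r)‖ ≤ (M/(m−1)) (T₀−r)^{1−m}` for every `r ≤ τ` — the trapped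
set is closed and, squeezed by the volume-preserving maps `φ(r, τ, ·)` (`KelvinPhysical.volume_image_evolutionMap`) into balls of radius `→ 0`
(`r → −∞`), Lebesgue-NULL (`FadingPowerPast.volume_trapped_eq_zero`) — OR at some `r₁ ≤ τ` it is outside that ball and then stays at distance
`≥ δ > 0` from the origin for all `r ≤ r₁`; there the stretching rate `D(T₀−r)^{−k}` is integrable and the source `‖ω(σ, P(σ))‖ ≤ 4D(T₀−σ)^{−k} → 0`,
so the two-time Cauchy formula with the PATHWISE Grönwall factor (`FadingPast.norm_curl_le_exp_integral_path`) gives `ω(r₁, P(r₁)) = 0` as `σ → −∞`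
(`FadingPowerPast.curl_eq_zero_of_escape_of_rpowRate`), and the Cauchy formula from `r₁` to `τ` transports the zero
(`FadingPast.curl_eq_zero_of_curl_eq_zero_earlier`).  Hence `curl u(τ) = 0` off a closed null set, so everywhere by continuity.

Sequel `…PowerClockNegRate`: the negative-rate tame power clocks of line `logtime-breathers` (residue T4 as left by
`…PowerClockTameProfile`: «the clocks `g ≤ 0` about `T₀ > 0`») are of this form.

WHAT THIS IS NOT: not NS regularity, not the crux E — 19832 is a crux CLASS on the MODEL lattice (E/NS strata); this is one more classical
stratum for the lead skeleton `Cruxes/PowerGaugeEulerLiouville/Lines/birth.lean` (LEAD ns-typeII-p2 g11), helper credit only.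
[folklore; MajdaBertozziCUP2002 §1.6 Prop 1.8 (1.51), §2.5 (2.115)–(2.117), §4.2 (4.46)–(4.47); line card `Lines/logtime-breathers.md` T2b/T4]
-/

noncomputable section

set_option linter.dupNamespace false

open MeasureTheory Set Filter Topology Metric Function
open scoped NNReal ENNReal ContDiff

namespace Summit.NavierStokesRegularity.NavierStokesRegularity.Theorems.PowerGaugeEulerLiouville.FadingPowerPast

open Literature.Analysis Literature.Analysis.FluidPDE

/-! ### Calculus of the algebraic rate `(T₀ − s)^{−k}` -/

section Rate

variable {T₀ k : ℝ}

/-- The antiderivative of the rate: `d/ds [(T₀ − s)^{1−k}/(k − 1)] = (T₀ − s)^{−k}` for `s < T₀`, `k ≠ 1`. [folklore] -/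
theorem hasDerivAt_rpow_antideriv (hk : k ≠ 1) {s : ℝ} (hs : s < T₀) :
    HasDerivAt (fun s : ℝ => (T₀ - s) ^ (1 - k) / (k - 1)) ((T₀ - s) ^ (-k)) s := by
  have hpos : 0 < T₀ - s := by linarith
  have h1 : HasDerivAt (fun s : ℝ => T₀ - s) (-1) s := by
    simpa using (hasDerivAt_id s).const_sub T₀
  have h2 := (h1.rpow_const (p := 1 - k) (Or.inl hpos.ne')).div_const (k - 1)
  refine h2.congr_deriv ?_
  have hk1 : k - 1 ≠ 0 := sub_ne_zero.2 hk
  rw [show (1 : ℝ) - k - 1 = -k by ring]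
  field_simp
  ring

/-- The rate is continuous on every interval to the left of `T₀`. [folklore] -/
theorem continuousOn_rpow_rate {a b : ℝ} (ha : a < T₀) (hb : b < T₀) (D : ℝ) :
    ContinuousOn (fun s : ℝ => D * (T₀ - s) ^ (-k)) (uIcc a b) := by
  refine ContinuousOn.mul continuousOn_const (ContinuousOn.rpow_const (by fun_prop) fun s hs => Or.inl ?_)
  rcases mem_uIcc.1 hs with ⟨_, h2⟩ | ⟨_, h2⟩
  · exact (sub_pos.2 (lt_of_le_of_lt h2 hb)).ne'
  · exact (sub_pos.2 (lt_of_le_of_lt h2 ha)).ne'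

/-- The integral of the rate between two times to the left of `T₀`:
`∫_a^b D (T₀ − s)^{−k} ds = D [(T₀ − b)^{1−k} − (T₀ − a)^{1−k}]/(k − 1)` (`k ≠ 1`). [folklore] -/
theorem integral_rpow_rate (hk : k ≠ 1) {a b : ℝ} (ha : a < T₀) (hb : b < T₀) (D : ℝ) :
    ∫ s in a..b, D * (T₀ - s) ^ (-k) =
      D * ((T₀ - b) ^ (1 - k) / (k - 1) - (T₀ - a) ^ (1 - k) / (k - 1)) := by
  rw [intervalIntegral.integral_const_mul]
  congr 1
  have hsub : ∀ s ∈ uIcc a b, s < T₀ := by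
    intro s hs
    rcases mem_uIcc.1 hs with ⟨_, h2⟩ | ⟨_, h2⟩
    · exact lt_of_le_of_lt h2 hb
    · exact lt_of_le_of_lt h2 ha
  have hc : ContinuousOn (fun s : ℝ => (T₀ - s) ^ (-k)) (uIcc a b) := by
    simpa using continuousOn_rpow_rate (k := k) ha hb 1
  exact intervalIntegral.integral_eq_sub_of_hasDerivAt (fun s hs => hasDerivAt_rpow_antideriv hk (hsub s hs))
    (hc.intervalIntegrable)

/-- For `r ≤ r₁ < T₀` and `k > 1`: `0 ≤ ∫_r^{r₁} D (T₀ − s)^{−k} ds ≤ D (T₀ − r₁)^{1−k}/(k − 1)` (`D ≥ 0`). [folklore] -/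
theorem integral_rpow_rate_bounds (hk : 1 < k) {D : ℝ} (hD : 0 ≤ D) {r r₁ : ℝ} (hr₁ : r₁ < T₀) (hr : r ≤ r₁) :
    0 ≤ ∫ s in r..r₁, D * (T₀ - s) ^ (-k) ∧
      ∫ s in r..r₁, D * (T₀ - s) ^ (-k) ≤ D * ((T₀ - r₁) ^ (1 - k) / (k - 1)) := by
  have hrT : r < T₀ := lt_of_le_of_lt hr hr₁
  have hk1 : 0 < k - 1 := by linarith
  rw [integral_rpow_rate hk.ne' hrT hr₁ D]
  have hmono : (T₀ - r) ^ (1 - k) ≤ (T₀ - r₁) ^ (1 - k) :=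
    Real.rpow_le_rpow_of_nonpos (by linarith) (by linarith) (by linarith)
  have hnn : 0 ≤ (T₀ - r) ^ (1 - k) := Real.rpow_nonneg (by linarith) _
  constructor
  · exact mul_nonneg hD (by rw [← sub_div]; exact div_nonneg (by linarith) hk1.le)
  · gcongr
    have : 0 ≤ (T₀ - r) ^ (1 - k) / (k - 1) := div_nonneg hnn hk1.le
    linarith

/-- `(T₀ − σ)^{−k} → 0` as `σ → −∞` (`k > 0`). [folklore] -/
theorem tendsto_rpow_rate_atBot (hk : 0 < k) (A : ℝ) :
    Tendsto (fun σ : ℝ => A * (T₀ - σ) ^ (-k)) atBot (𝓝 0) := by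
  have h1 : Tendsto (fun σ : ℝ => T₀ - σ) atBot atTop := by
    have h := tendsto_atTop_add_const_left atBot T₀ tendsto_neg_atBot_atTop
    simpa [sub_eq_add_neg] using h
  have h2 := ((tendsto_rpow_neg_atTop hk).comp h1).const_mul A
  simpa using h2

end Rate

/-! ### The kill along an escaped trajectory, algebraic rate -/

section Escape

variable {u : ℝ → EuclideanSpace ℝ (Fin 3) → EuclideanSpace ℝ (Fin 3)} {p : ℝ → EuclideanSpace ℝ (Fin 3) → ℝ}
  {T₁ T₀ : ℝ}

/-- **KILL ALONG AN ESCAPED TRAJECTORY, algebraic rate.**  Classical Euler on `(−∞, T₁)`, `T₁ ≤ T₀`, with `K`-Lipschitz slices; suppose the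
gradient decays ALGEBRAICALLY IN TIME OFF A BALL: `‖∇u(s, y)‖ ≤ D (T₀ − s)^{−k}` for `s < T₁`, `‖y‖ ≥ δ` (`k > 1`, `D ≥ 0`).  If the fluid particle
sitting at `x₁` at time `r₁ < T₁` had `‖φ(r, r₁, x₁)‖ ≥ δ` for all `r ≤ r₁`, then `ω(r₁, x₁) = 0`: the Cauchy formula from `σ` to `r₁` with the
pathwise Grönwall factor `exp(D (T₀−r₁)^{1−k}/(k−1))` and the source `‖ω(σ, ·)‖ ≤ 4 D (T₀−σ)^{−k} → 0` (`σ → −∞`).  Power-law twin of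
`FadingPast.curl_eq_zero_of_escape_of_expRate`. [folklore; MajdaBertozziCUP2002 §2.5 (2.117), §4.2 (4.47)] -/
theorem curl_eq_zero_of_escape_of_rpowRate (hcl : IsClassicalEulerSolutionOn (Iio T₁) 0 u p) (hT : T₁ ≤ T₀)
    {K : ℝ≥0} (hK : ∀ s : ℝ, s < T₁ → LipschitzWith K (u s)) (hL : ODE.IsUniformlyLipschitzOn u (Iio T₁))
    {k D δ : ℝ} (hk : 1 < k) (hD : 0 ≤ D)
    (htame : ∀ s : ℝ, s < T₁ → ∀ y : EuclideanSpace ℝ (Fin 3), δ ≤ ‖y‖ → ‖fderiv ℝ (u s) y‖ ≤ D * (T₀ - s) ^ (-k))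
    {r₁ : ℝ} (hr₁ : r₁ < T₁) (x₁ : EuclideanSpace ℝ (Fin 3))
    (hfar : ∀ r : ℝ, r ≤ r₁ → δ ≤ ‖ODE.evolutionMap u r₁ r x₁‖) :
    curl (u r₁) x₁ = 0 := by
  have hS : Convex ℝ (Iio T₁) := convex_Iio _
  have hr₁T₀ : r₁ < T₀ := lt_of_lt_of_le hr₁ hT
  have hk1 : 0 < k - 1 := by linarith
  -- the Grönwall constant
  set A : ℝ := Real.exp (D * ((T₀ - r₁) ^ (1 - k) / (k - 1))) * (4 * D) with hA
  have hbound : ∀ σ : ℝ, σ < r₁ → ‖curl (u r₁) x₁‖ ≤ A * (T₀ - σ) ^ (-k) := by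
    intro σ hσ
    have hσT : σ < T₁ := hσ.trans hr₁
    have hσT₀ : σ < T₀ := hσ.trans hr₁T₀
    -- pathwise rate along `s ↦ φ(s, σ, φ(σ, r₁, x₁)) = φ(s, r₁, x₁)`
    have hpath : ∀ s ∈ uIcc σ r₁,
        ‖fderiv ℝ (u s) (ODE.evolutionMap u σ s (ODE.evolutionMap u r₁ σ x₁))‖ ≤ D * (T₀ - s) ^ (-k) := by
      intro s hs
      rw [uIcc_of_le hσ.le] at hs
      have hsT : s < T₁ := lt_of_le_of_lt hs.2 hr₁
      rw [hL.evolutionMap_trans hS hr₁ hσT hsT]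
      exact htame s hsT _ (hfar s hs.2)
    have h1 := FadingPast.norm_curl_le_exp_integral_path hcl hK hL hσT hr₁ x₁ (M := fun s => D * (T₀ - s) ^ (-k))
      (continuousOn_rpow_rate hσT₀ hr₁T₀ D) hpath
    -- the source at time `σ`
    have hsrc : ‖curl (u σ) (ODE.evolutionMap u r₁ σ x₁)‖ ≤ 4 * (D * (T₀ - σ) ^ (-k)) :=
      (norm_curl_le_four_mul _ _).trans
        (mul_le_mul_of_nonneg_left (htame σ hσT _ (hfar σ hσ.le)) (by norm_num))
    -- the integral of the rate
    obtain ⟨hI0, hI1⟩ := integral_rpow_rate_bounds (T₀ := T₀) hk hD hr₁T₀ hσ.le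
    have hint_le : |∫ s in σ..r₁, D * (T₀ - s) ^ (-k)| ≤ D * ((T₀ - r₁) ^ (1 - k) / (k - 1)) := by
      rwa [abs_of_nonneg hI0]
    have hrate0 : 0 ≤ (T₀ - σ) ^ (-k) := Real.rpow_nonneg (by linarith) _
    calc ‖curl (u r₁) x₁‖
        ≤ Real.exp |∫ s in σ..r₁, D * (T₀ - s) ^ (-k)| * ‖curl (u σ) (ODE.evolutionMap u r₁ σ x₁)‖ := h1
      _ ≤ Real.exp (D * ((T₀ - r₁) ^ (1 - k) / (k - 1))) * (4 * (D * (T₀ - σ) ^ (-k))) := by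
          gcongr
      _ = A * (T₀ - σ) ^ (-k) := by rw [hA]; ring
  -- let `σ → −∞`
  have hlim : Tendsto (fun σ : ℝ => A * (T₀ - σ) ^ (-k)) atBot (𝓝 0) :=
    tendsto_rpow_rate_atBot (by linarith) A
  rw [← norm_le_zero_iff]
  exact ge_of_tendsto hlim ((eventually_lt_atBot r₁).mono fun σ hσ => hbound σ hσ)

end Escape

/-! ### The algebraically fading past: displacement, trapped set, conclusion -/

section Fading

variable {u : ℝ → EuclideanSpace ℝ (Fin 3) → EuclideanSpace ℝ (Fin 3)} {p : ℝ → EuclideanSpace ℝ (Fin 3) → ℝ}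
  {T₁ T₀ M m : ℝ}

/-- The constant of a velocity envelope `‖u(s, y)‖ ≤ M (T₀ − s)^{−m}` (tested at one time `s < T₁ ≤ T₀`) is non-negative. [folklore] -/
theorem envelope_nonneg (hT : T₁ ≤ T₀) (hvel : ∀ s : ℝ, s < T₁ → ∀ y, ‖u s y‖ ≤ M * (T₀ - s) ^ (-m))
    {s : ℝ} (hs : s < T₁) : 0 ≤ M := by
  have hpos : 0 < (T₀ - s) ^ (-m) := Real.rpow_pos_of_pos (by linarith) _
  have h := (norm_nonneg _).trans (hvel s hs 0)
  nlinarith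

/-- Uniformly Lipschitz slices give the Cauchy–Lipschitz hypotheses on `(−∞, T₁)`. [folklore] -/
theorem isUniformlyLipschitzOn_of_lipschitz (hcl : IsClassicalEulerSolutionOn (Iio T₁) 0 u p)
    {K : ℝ≥0} (hK : ∀ s : ℝ, s < T₁ → LipschitzWith K (u s)) : ODE.IsUniformlyLipschitzOn u (Iio T₁) :=
  hcl.smooth_velocity.isUniformlyLipschitzOn_of_norm_fderiv_le fun _ _ hCS =>
    ⟨K, fun s hs _ => norm_fderiv_le_of_lipschitz ℝ (hK s (hCS hs))⟩

/-- **Finite backward displacement**: with `‖u(s, ·)‖ ≤ M (T₀ − s)^{−m}` (`m > 1`, `T₁ ≤ T₀`), a fluid particle moves by at most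
`(M/(m−1)) (T₀ − r₁)^{1−m}` between the times `r ≤ r₁ < T₁`: `‖φ(r, r₁, y) − y‖ ≤ (M/(m−1)) (T₀ − r₁)^{1−m}`.  Power-law twin of
`FadingPast.norm_evolutionMap_sub_le`. [cite: MajdaBertozziCUP2002, §4.2 eq. (4.46)] -/
theorem norm_evolutionMap_sub_le (hL : ODE.IsUniformlyLipschitzOn u (Iio T₁)) (hT : T₁ ≤ T₀) (hm : 1 < m)
    (hvel : ∀ s : ℝ, s < T₁ → ∀ y, ‖u s y‖ ≤ M * (T₀ - s) ^ (-m))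
    {r₁ r : ℝ} (hr₁ : r₁ < T₁) (hr : r ≤ r₁) (y : EuclideanSpace ℝ (Fin 3)) :
    ‖ODE.evolutionMap u r₁ r y - y‖ ≤ M / (m - 1) * (T₀ - r₁) ^ (1 - m) := by
  have hrT : r < T₁ := lt_of_le_of_lt hr hr₁
  have hr₁T₀ : r₁ < T₀ := lt_of_lt_of_le hr₁ hT
  have hrT₀ : r < T₀ := lt_of_lt_of_le hrT hT
  have hM0 : 0 ≤ M := envelope_nonneg hT hvel hr₁
  have hsub : uIcc r₁ r ⊆ Iio T₁ := (convex_Iio T₁).ordConnected.uIcc_subset hr₁ hrT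
  have h1 := norm_evolutionMap_sub_self_le_abs_integral hL (convex_Iio _) hr₁ hrT
    (V := fun s => M * (T₀ - s) ^ (-m)) (continuousOn_rpow_rate hr₁T₀ hrT₀ M) (fun s hs z => hvel s (hsub hs) z) y
  refine h1.trans ?_
  obtain ⟨hI0, hI1⟩ := integral_rpow_rate_bounds (T₀ := T₀) hm hM0 hr₁T₀ hr
  rw [intervalIntegral.integral_symm, abs_neg, abs_of_nonneg hI0]
  calc ∫ s in r..r₁, M * (T₀ - s) ^ (-m) ≤ M * ((T₀ - r₁) ^ (1 - m) / (m - 1)) := hI1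
    _ = M / (m - 1) * (T₀ - r₁) ^ (1 - m) := by ring

/-! The TRAPPED SET at time `τ` is `{x | ∀ r ≤ τ, ‖φ(r, τ, x)‖ ≤ (M/(m−1)) (T₀ − r)^{1−m}}`: the points whose backward trajectory
converges to the origin at the fading rate (written out in each statement; no definition is introduced). -/

/-- The trapped set is closed (continuity of the particle-trajectory maps). [folklore] -/
theorem isClosed_trapped (hcl : IsClassicalEulerSolutionOn (Iio T₁) 0 u p)
    (hL : ODE.IsUniformlyLipschitzOn u (Iio T₁)) {τ : ℝ} (hτ : τ < T₁) :
    IsClosed {x : EuclideanSpace ℝ (Fin 3) |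
      ∀ r : ℝ, r ≤ τ → ‖ODE.evolutionMap u τ r x‖ ≤ M / (m - 1) * (T₀ - r) ^ (1 - m)} := by
  have h : {x : EuclideanSpace ℝ (Fin 3) |
      ∀ r : ℝ, r ≤ τ → ‖ODE.evolutionMap u τ r x‖ ≤ M / (m - 1) * (T₀ - r) ^ (1 - m)} =
      ⋂ r : ℝ, ⋂ (_ : r ≤ τ), {x | ‖ODE.evolutionMap u τ r x‖ ≤ M / (m - 1) * (T₀ - r) ^ (1 - m)} := by
    ext x; simp
  rw [h]
  refine isClosed_iInter fun r => isClosed_iInter fun hr => ?_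
  have hcont : Continuous (ODE.evolutionMap u τ r) :=
    (hL.contDiff_evolutionMap (convex_Iio _) (uniqueDiffOn_Iio _) le_top hcl.smooth_velocity hτ
      (lt_of_le_of_lt hr hτ)).continuous
  exact isClosed_le (continuous_norm.comp hcont) continuous_const

/-- **THE TRAPPED SET IS NULL**: the volume-preserving maps `φ(r, τ, ·)` squeeze it into the balls `B(0, (M/(m−1)) (T₀ − r)^{1−m})`,
whose radii tend to `0` as `r → −∞` (`m > 1`). [cite: MajdaBertozziCUP2002, §1.3 Def. 1.1, Prop. 1.4 (incompressibility)] -/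
theorem volume_trapped_eq_zero (hcl : IsClassicalEulerSolutionOn (Iio T₁) 0 u p)
    (hL : ODE.IsUniformlyLipschitzOn u (Iio T₁)) (hT : T₁ ≤ T₀) (hm : 1 < m) (hM : 0 ≤ M) {τ : ℝ} (hτ : τ < T₁) :
    volume {x : EuclideanSpace ℝ (Fin 3) |
      ∀ r : ℝ, r ≤ τ → ‖ODE.evolutionMap u τ r x‖ ≤ M / (m - 1) * (T₀ - r) ^ (1 - m)} = 0 := by
  have hS : Convex ℝ (Iio T₁) := convex_Iio _
  have hU : UniqueDiffOn ℝ (Iio T₁) := uniqueDiffOn_Iio _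
  have hm1 : 0 < m - 1 := by linarith
  set T : Set (EuclideanSpace ℝ (Fin 3)) := {x : EuclideanSpace ℝ (Fin 3) |
      ∀ r : ℝ, r ≤ τ → ‖ODE.evolutionMap u τ r x‖ ≤ M / (m - 1) * (T₀ - r) ^ (1 - m)} with hT'
  have hmeas : MeasurableSet T := (isClosed_trapped hcl hL hτ).measurableSet
  set V₁ : ℝ≥0∞ := volume (ball (0 : EuclideanSpace ℝ (Fin 3)) 1) with hV₁
  have hV₁top : V₁ ≠ ⊤ := measure_ball_lt_top.ne
  -- squeezing: `vol T ≤ R(r)³ · vol B₁` for every `r ≤ τ`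
  have hsq : ∀ r : ℝ, r ≤ τ →
      volume T ≤ ENNReal.ofReal ((M / (m - 1) * (T₀ - r) ^ (1 - m)) ^ 3) * V₁ := by
    intro r hr
    have hrT : r < T₁ := lt_of_le_of_lt hr hτ
    have hR : 0 ≤ M / (m - 1) * (T₀ - r) ^ (1 - m) :=
      mul_nonneg (div_nonneg hM hm1.le) (Real.rpow_nonneg (by linarith) _)
    have himg : ODE.evolutionMap u τ r '' T ⊆
        closedBall (0 : EuclideanSpace ℝ (Fin 3)) (M / (m - 1) * (T₀ - r) ^ (1 - m)) := by
      rintro _ ⟨x, hx, rfl⟩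
      rw [mem_closedBall, dist_zero_right]
      exact hx r hr
    calc volume T
        = volume (ODE.evolutionMap u τ r '' T) :=
          (KelvinPhysical.volume_image_evolutionMap hcl hL hS hU hτ hrT hmeas).symm
      _ ≤ volume (closedBall (0 : EuclideanSpace ℝ (Fin 3)) (M / (m - 1) * (T₀ - r) ^ (1 - m))) := measure_mono himg
      _ = ENNReal.ofReal ((M / (m - 1) * (T₀ - r) ^ (1 - m)) ^ 3) * V₁ := by
          rw [Measure.addHaar_closedBall _ _ hR, finrank_euclideanSpace_fin]
  -- the right-hand side tends to `0` as `r → −∞`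
  have hlim : Tendsto (fun r : ℝ => ENNReal.ofReal ((M / (m - 1) * (T₀ - r) ^ (1 - m)) ^ 3) * V₁) atBot (𝓝 0) := by
    have h1 : Tendsto (fun r : ℝ => M / (m - 1) * (T₀ - r) ^ (1 - m)) atBot (𝓝 0) := by
      have h := tendsto_rpow_rate_atBot (T₀ := T₀) (k := m - 1) hm1 (M / (m - 1))
      simpa [neg_sub] using h
    have h2 : Tendsto (fun r : ℝ => (M / (m - 1) * (T₀ - r) ^ (1 - m)) ^ 3) atBot (𝓝 (0 ^ 3)) := h1.pow 3
    rw [zero_pow three_ne_zero] at h2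
    have h3 := ENNReal.tendsto_ofReal h2
    rw [ENNReal.ofReal_zero] at h3
    have h4 := ENNReal.Tendsto.mul_const h3 (Or.inr hV₁top)
    rwa [zero_mul] at h4
  refine le_antisymm (ge_of_tendsto hlim ((eventually_le_atBot τ).mono fun r hr => hsq r hr)) bot_le

/-- **OFF THE TRAPPED SET THE VORTICITY VANISHES**: if `x ∉ T_τ`, some `r₁ ≤ τ` has `‖φ(r₁, τ, x)‖ > (M/(m−1)) (T₀−r₁)^{1−m}`; the particle
then stays at distance `≥ δ = ‖φ(r₁, τ, x)‖ − (M/(m−1))(T₀−r₁)^{1−m} > 0` from the origin before `r₁` (finite displacement), so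
`ω(r₁, φ(r₁, τ, x)) = 0` (`curl_eq_zero_of_escape_of_rpowRate` with the gradient decay off the `δ`-ball), and the Cauchy formula from `r₁`
to `τ` transports the zero. [folklore] -/
theorem curl_eq_zero_of_not_mem_trapped (hcl : IsClassicalEulerSolutionOn (Iio T₁) 0 u p) (hT : T₁ ≤ T₀) (hm : 1 < m)
    (hvel : ∀ s : ℝ, s < T₁ → ∀ y, ‖u s y‖ ≤ M * (T₀ - s) ^ (-m))
    {K : ℝ≥0} (hK : ∀ s : ℝ, s < T₁ → LipschitzWith K (u s))
    (hgrad : ∀ δ : ℝ, 0 < δ → ∃ D k : ℝ, 1 < k ∧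
      ∀ s : ℝ, s < T₁ → ∀ y : EuclideanSpace ℝ (Fin 3), δ ≤ ‖y‖ → ‖fderiv ℝ (u s) y‖ ≤ D * (T₀ - s) ^ (-k))
    {τ : ℝ} (hτ : τ < T₁) {x : EuclideanSpace ℝ (Fin 3)}
    (hx : x ∉ {x : EuclideanSpace ℝ (Fin 3) |
      ∀ r : ℝ, r ≤ τ → ‖ODE.evolutionMap u τ r x‖ ≤ M / (m - 1) * (T₀ - r) ^ (1 - m)}) :
    curl (u τ) x = 0 := by
  have hL := isUniformlyLipschitzOn_of_lipschitz hcl hK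
  simp only [mem_setOf_eq, not_forall, not_le, exists_prop] at hx
  obtain ⟨r₁, hr₁, hbig⟩ := hx
  have hr₁T : r₁ < T₁ := lt_of_le_of_lt hr₁ hτ
  set x₁ := ODE.evolutionMap u τ r₁ x with hx₁
  set δ : ℝ := ‖x₁‖ - M / (m - 1) * (T₀ - r₁) ^ (1 - m) with hδ
  have hδ0 : 0 < δ := by rw [hδ]; linarith
  have hfar : ∀ r : ℝ, r ≤ r₁ → δ ≤ ‖ODE.evolutionMap u r₁ r x₁‖ := by
    intro r hr
    have h1 := norm_evolutionMap_sub_le hL hT hm hvel hr₁T hr x₁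
    have h2 := norm_sub_norm_le x₁ (ODE.evolutionMap u r₁ r x₁)
    rw [← norm_neg, neg_sub] at h1
    rw [hδ]; linarith
  obtain ⟨D, k, hk, htame⟩ := hgrad δ hδ0
  -- `D ≥ 0`: test the bound at the particle's position at time `r₁` (norm `≥ δ`)
  have hD : 0 ≤ D := by
    have h := (norm_nonneg _).trans (htame r₁ hr₁T _ (hfar r₁ le_rfl))
    have hpos : 0 < (T₀ - r₁) ^ (-k) := Real.rpow_pos_of_pos (by linarith [lt_of_lt_of_le hr₁T hT]) _
    nlinarith
  have hzero : curl (u r₁) x₁ = 0 :=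
    curl_eq_zero_of_escape_of_rpowRate hcl hT hK hL hk hD htame hr₁T x₁ hfar
  exact FadingPast.curl_eq_zero_of_curl_eq_zero_earlier hcl hK hr₁T hτ x hzero

/-- **A CLASSICAL EULER FLOW WITH AN ALGEBRAICALLY FADING TAME PAST IS IRROTATIONAL**: on `(−∞, T₁)`, `T₁ ≤ T₀`: `‖u(t,y)‖ ≤ M (T₀−t)^{−m}`
(`m > 1`), slices `K`-Lipschitz, and for every `δ > 0` some `D`, `k > 1` with `‖∇u(t,y)‖ ≤ D (T₀−t)^{−k}` for `‖y‖ ≥ δ` ⇒ `curl u(τ) ≡ 0` for every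
`τ < T₁` (the vorticity vanishes off the closed null trapped set, hence everywhere by continuity). [folklore; line `logtime-breathers` T2b/T4] -/
theorem curl_eq_zero (hcl : IsClassicalEulerSolutionOn (Iio T₁) 0 u p) (hT : T₁ ≤ T₀) (hm : 1 < m)
    (hvel : ∀ s : ℝ, s < T₁ → ∀ y, ‖u s y‖ ≤ M * (T₀ - s) ^ (-m))
    {K : ℝ≥0} (hK : ∀ s : ℝ, s < T₁ → LipschitzWith K (u s))
    (hgrad : ∀ δ : ℝ, 0 < δ → ∃ D k : ℝ, 1 < k ∧
      ∀ s : ℝ, s < T₁ → ∀ y : EuclideanSpace ℝ (Fin 3), δ ≤ ‖y‖ → ‖fderiv ℝ (u s) y‖ ≤ D * (T₀ - s) ^ (-k))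
    {τ : ℝ} (hτ : τ < T₁) (x : EuclideanSpace ℝ (Fin 3)) : curl (u τ) x = 0 := by
  have hL := isUniformlyLipschitzOn_of_lipschitz hcl hK
  have hM : 0 ≤ M := envelope_nonneg hT hvel hτ
  set T : Set (EuclideanSpace ℝ (Fin 3)) := {x : EuclideanSpace ℝ (Fin 3) |
      ∀ r : ℝ, r ≤ τ → ‖ODE.evolutionMap u τ r x‖ ≤ M / (m - 1) * (T₀ - r) ^ (1 - m)} with hT'
  have hnull : volume T = 0 := volume_trapped_eq_zero hcl hL hT hm hM hτ
  have hdense : Dense Tᶜ := by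
    rw [← interior_eq_empty_iff_dense_compl]
    by_contra hne
    have hpos := (isOpen_interior.measure_pos volume (nonempty_iff_ne_empty.2 hne))
    have hle : volume (interior T) ≤ 0 := hnull ▸ measure_mono interior_subset
    exact absurd (lt_of_lt_of_le hpos hle) (lt_irrefl _)
  have hcont : Continuous (curl (u τ)) :=
    continuous_curl ((hcl.contDiff_velocity hτ).of_le (by exact_mod_cast le_top))
  have h := Continuous.ext_on hdense hcont continuous_const fun y hy =>
    curl_eq_zero_of_not_mem_trapped hcl hT hm hvel hK hgrad hτ hy
  exact congrFun h x

/-! ### Member level -/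

/-- **MEMBERS WITH AN ALGEBRAICALLY FADING TAME PAST ARE TRIVIAL.**  Crux hypotheses verbatim (`0 < ρ ≤ ½`) + `(u, p)` classical on a past
sub-slab `(−∞, T₁)`, `T₁ ≤ 0`, `T₁ ≤ T₀`, with `‖u(t,y)‖ ≤ M (T₀−t)^{−m}` (`m > 1`), `K`-Lipschitz slices, and for every `δ > 0` constants `D`, `k > 1`
with `‖∇u(t,y)‖ ≤ D (T₀−t)^{−k}` whenever `‖y‖ ≥ δ` (nothing assumed on `[T₁, 0)`) ⇒ `u = 0` a.e. on `(−∞, 0) × ℝ³`: the past is classical,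
incompressible and irrotational (`curl_eq_zero`), and the tree's `PastIrrotational.ae_eq_zero_of_gauge_of_pastIrrotational` (harmonic slices
killed by the `A`-gauge, then the energy stratum) concludes.  The negative-rate tame power clocks of line `logtime-breathers` are the model case
(sequel `…PowerClockNegRate`). [folklore; line card `Lines/logtime-breathers.md` T2b/T4] -/
theorem ae_eq_zero_of_gauge_of_fadingPowerPast {ρ : ℝ} (hρ : 0 < ρ) (hρh : ρ ≤ 1 / 2)
    {H : ℝ → EuclideanSpace ℝ (Fin 3) → EuclideanSpace ℝ (Fin 3) →L[ℝ] EuclideanSpace ℝ (Fin 3)} {c₀ : ℝ≥0}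
    (hsw : IsSuitableWeakSolutionOn (slab (EuclideanSpace ℝ (Fin 3)) (Iio 0) isOpen_Iio) 0 0 u p)
    (hH : HasWeakSpatialGradientOn (slab (EuclideanSpace ℝ (Fin 3)) (Iio 0) isOpen_Iio) u H)
    (hgauge : ∀ a : ℝ, 0 < a →
      ENNReal.ofReal (a ^ (2 * ρ)) * cknA a (0 : ℝ × EuclideanSpace ℝ (Fin 3)) u +
          ENNReal.ofReal (a ^ ρ) * cknE a (0 : ℝ × EuclideanSpace ℝ (Fin 3)) H +
        ENNReal.ofReal (a ^ (2 * ρ)) * cknD a (0 : ℝ × EuclideanSpace ℝ (Fin 3)) p ≤ (c₀ : ℝ≥0∞))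
    (hT₁ : T₁ ≤ 0) (hT : T₁ ≤ T₀) (hcl : IsClassicalEulerSolutionOn (Iio T₁) 0 u p) (hm : 1 < m)
    (hvel : ∀ s : ℝ, s < T₁ → ∀ y, ‖u s y‖ ≤ M * (T₀ - s) ^ (-m))
    {K : ℝ≥0} (hK : ∀ s : ℝ, s < T₁ → LipschitzWith K (u s))
    (hgrad : ∀ δ : ℝ, 0 < δ → ∃ D k : ℝ, 1 < k ∧
      ∀ s : ℝ, s < T₁ → ∀ y : EuclideanSpace ℝ (Fin 3), δ ≤ ‖y‖ → ‖fderiv ℝ (u s) y‖ ≤ D * (T₀ - s) ^ (-k)) :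
    uncurry u =ᵐ[volume.restrict (Iio (0 : ℝ) ×ˢ (univ : Set (EuclideanSpace ℝ (Fin 3))))] 0 :=
  PastIrrotational.ae_eq_zero_of_gauge_of_pastIrrotational hρ hρh hsw hH hgauge hT₁
    (fun τ hτ => (hcl.contDiff_velocity hτ).of_le (by norm_cast))
    (fun τ hτ => hcl.divFree τ hτ) (fun τ hτ x => curl_eq_zero hcl hT hm hvel hK hgrad hτ x)

end Fading

end Summit.NavierStokesRegularity.NavierStokesRegularity.Theorems.PowerGaugeEulerLiouville.FadingPowerPast
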